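import Mathlib
import Summits.Ventures.HodgeRepro.Tier4.Common.Geometry
import Summits.Ventures.HodgeRepro.PeriodCloserC7Identification

/-!
# Tier4/Common/Automorphic — the automorphic side of (P): the theta lifts `θ(μ_j)` of the four `U(1)`-characters,
the identification `f^*ω_j = θ(μ_j)`, and the bridge to the landed period-closer vocabulary (`C7Face`,
`DoublingInterface`)

Blind re-derivation cell `pub-hodge-repro`, Tier 4 (README §9–§10), seat t4-typer-2 (gen 0).  Target tree path
`lean/Summits/Ventures/HodgeRepro/Tier4/Common/Automorphic.lean`.  Imports the seam `Tier4/Common/Forms.lean` and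
the geometric side `Tier4/Common/Geometry.lean` (t4-typer-1: `FormAlgebra Form`, `HeckeAction A`, `Witness A` with
`omega : Fin 4 → Form`, `Translates`, `pullOmega`, `pullOmegaS`, `pullOmegaSbar`, `hodgePairing`, `Witness.P`) and
night-2's `PeriodCloserC7Identification.lean` (`C7Face L`, `DoublingInterface I`, the components (D0)–(D4)).

THE SENTENCE (route/TIER3.md §1 item 3): «**(P) for some choice of the Hecke translates, ⟨f^*Ω_s, f^*Ω_{s̄}⟩_{L²(X)}
≠ 0** — X a compact 2-ball quotient …, f the product of Hecke-translated Albanese maps, f^*Ω_s = θ(μ_0) ∧ θ(μ_1) and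
f^*Ω_{s̄} = θ(μ_2) ∧ θ(μ_3) wedges of theta lifts of U(1)-characters (BMM Cor 65 / Liu Prop 4.13, PRINTED).»

WHAT IS TYPED HERE (the automorphic objects of the sentence, as parameters with their defining properties):
* `ThetaLifts W` — the `U(1)`-characters `μ_0, …, μ_3` of the four corners and the theta lift `θ : U1Char → Form`
  (a holomorphic `1`-form on `X`), with the PRINTED identification of the sentence, `f^*ω_j = θ(μ_j)`: the corner
  `1`-form `W.omega j` IS `theta (mu j)` (`omega_eq_theta`; BMM Cor 65 / Liu Prop 4.13, the route's «H^{1,0}(X) is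
  spanned by theta lifts of characters of U(1)»).  With the translates of a choice `γ`, `f^*Ω_s = T_{γ_0}^* θ(μ_0)
  ∧ T_{γ_1}^* θ(μ_1)` (`pullOmegaS_eq`) and `f^*Ω_{s̄} = T_{γ_2}^* θ(μ_2) ∧ T_{γ_3}^* θ(μ_3)` (`pullOmegaSbar_eq`).
* `EndoscopicSide L W Θ` — what the landed chain needs beyond the geometry to speak about the datum: the
  Hecke-character interface of the CM field `L` (night-2's `HeckeInterface L`: places, self-dual Hecke characters,
  root numbers, central values, anticyclotomic twists), the sealed seesaw datum, the four characters `χ′_j` of a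
  choice of translates, the torus period, and the `U(W)`-side (`Tau`, `Θ(β)`, toric periods, the lift).  From it,
  `toC7Face : C7Face L` with `Datum := W.Translates` and `hodgePairing := W.hodgePairing`, so that
  **`(toC7Face E).P ↔ W.P` by `Iff.rfl`** (`toC7Face_P`): every theorem of `PeriodCloserC7Chain` /
  `PeriodCloserC7Identification` over `C7Face` applies to the Tier-4 datum by name.
* `TorusSide W` + `toDoubling` — the `DoublingInterface` of night-2 built on the seam: `Form`, `hodge`, `wedge`
  from `FormAlgebra`, `cornerForm := W.pullOmega`, `lineLift γ j := T_{γ_j}^* θ(μ_j)`, `planeLift γ i :=` the wedge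
  of the two line lifts of the torus `i`; the points of `[T × T′]`, the period functional, the theta integral and the
  Siegel–Eisenstein series are the fields of `TorusSide`.  Then (D0) `CornerLifts`, (D1) `WitnessForms`, (D2)
  `CupProduct` HOLD (`cornerLifts_toDoubling`, `witnessForms_toDoubling`, `cupProduct_toDoubling`): in this
  vocabulary they are definitions, and what the doubling form still needs is exactly (D3) `DoublingIdentity`, (D4)
  `SiegelWeil` and the definitional match `TorusPeriodDef` (`doublingComponents_of`), then the seesaw (S1)–(S3).

WHAT AN INTERFACE CAN AND CANNOT SAY.  Every field is a parameter; a theorem proved over these structures is a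
theorem about every instantiation and exactly as strong as the listed properties — in particular the universal
closure of `Witness.P` over `Forms`/`Geometry` alone is FALSE (t4-typer-2 S11875, t4-crit-1 S11870: kernel-checked
degenerate instances), and nothing in this file changes that; it only names the automorphic objects.  Nothing here
says anything about the status of the Hodge conjecture for CM abelian varieties, which is NOT proved (HC_CM is NOT
proved by anyone in this repository).
-/

set_option autoImplicit false

noncomputable section

namespace Summit.Ventures.HodgeRepro.Tier4.Common

open NumberField PeriodCloser

/-! ## The theta lifts of the four `U(1)`-characters -/

/-- **The theta lifts of (P)**: the `U(1)`-characters `μ_0, …, μ_3` of the four corners (lines `0, 1` = the two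
corners containing the embedding `s`, lines `2, 3` = the two containing `s̄`), the theta lift `θ(μ)`, a holomorphic
`1`-form on `X` (BMM Cor 65 / Liu Prop 4.13), and the PRINTED identification of the sentence: the pulled-back
eigen-`1`-form of the `j`-th corner IS the theta lift of its character, `f^*ω_j = θ(μ_j)`. -/
structure ThetaLifts {Form : Type} [AddCommGroup Form] [Module ℂ Form] {A : FormAlgebra Form} (W : Witness A) where
  /-- the `U(1)`-characters that can be lifted -/
  U1Char : Type
  /-- the four characters of the datum, line by line -/
  mu : Fin 4 → U1Char
  /-- the theta lift `μ ↦ θ(μ)`, a holomorphic `1`-form on `X` -/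
  theta : U1Char → Form
  /-- theta lifts are holomorphic `1`-forms -/
  theta_mem : ∀ μ : U1Char, theta μ ∈ A.H10
  /-- the sentence's identification `f^*ω_j = θ(μ_j)` (BMM Cor 65 / Liu Prop 4.13, PRINTED): the corner form of
  line `j` is the theta lift of its character -/
  omega_eq_theta : ∀ j : Fin 4, W.omega j = theta (mu j)

namespace ThetaLifts

variable {Form : Type} [AddCommGroup Form] [Module ℂ Form] {A : FormAlgebra Form} {W : Witness A}
  (Θ : ThetaLifts W)

/-- The theta lift of line `j`, `θ(μ_j)`. -/
def lift (j : Fin 4) : Form := Θ.theta (Θ.mu j)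

/-- The translated theta lift of line `j` for the choice `γ`: `T_{γ_j}^* θ(μ_j)`. -/
def translatedLift (γ : W.Translates) (j : Fin 4) : Form := W.translate (γ j) (Θ.lift j)

/-- `θ(μ_j)` is a holomorphic `1`-form. -/
theorem lift_mem (j : Fin 4) : Θ.lift j ∈ A.H10 := Θ.theta_mem _

/-- The corner form IS the lift. -/
theorem omega_eq_lift (j : Fin 4) : W.omega j = Θ.lift j := Θ.omega_eq_theta j

/-- The lifts are non-zero (the corners are isogeny factors of the Albanese: `Witness.omega_ne`). -/
theorem lift_ne (j : Fin 4) : Θ.lift j ≠ 0 := by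
  rw [← Θ.omega_eq_lift]; exact W.omega_ne j

/-- `f^*ω_j = T_{γ_j}^* θ(μ_j)`. -/
theorem pullOmega_eq (γ : W.Translates) (j : Fin 4) : W.pullOmega γ j = Θ.translatedLift γ j := by
  simp only [Witness.pullOmega, translatedLift, Θ.omega_eq_lift]

/-- **`f^*Ω_s = θ(μ_0) ∧ θ(μ_1)`** with the translates of `γ`. -/
theorem pullOmegaS_eq (γ : W.Translates) :
    W.pullOmegaS γ = A.wedge (Θ.translatedLift γ 0) (Θ.translatedLift γ 1) := by
  simp only [Witness.pullOmegaS, Θ.pullOmega_eq]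

/-- **`f^*Ω_{s̄} = θ(μ_2) ∧ θ(μ_3)`** with the translates of `γ`. -/
theorem pullOmegaSbar_eq (γ : W.Translates) :
    W.pullOmegaSbar γ = A.wedge (Θ.translatedLift γ 2) (Θ.translatedLift γ 3) := by
  simp only [Witness.pullOmegaSbar, Θ.pullOmega_eq]

/-- **(P) in the automorphic vocabulary**: `∃ γ, ⟨T_{γ_0}^*θ(μ_0) ∧ T_{γ_1}^*θ(μ_1), T_{γ_2}^*θ(μ_2) ∧ T_{γ_3}^*θ(μ_3)⟩ ≠ 0`. -/
theorem P_iff_theta : W.P ↔ ∃ γ : W.Translates,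
    A.hodge (A.wedge (Θ.translatedLift γ 0) (Θ.translatedLift γ 1))
      (A.wedge (Θ.translatedLift γ 2) (Θ.translatedLift γ 3)) ≠ 0 := by
  unfold Witness.P Witness.hodgePairing
  simp only [Θ.pullOmegaS_eq, Θ.pullOmegaSbar_eq]

end ThetaLifts

/-! ## The endoscopic side and the bridge to the landed `C7Face` -/

/-- **The endoscopic side of the datum** — everything night-2's face interface `C7Face L` carries beyond the geometry:
the Hecke-character interface of the CM field `L` (places, the self-dual Hecke characters `χ′_j`, root numbers,
central values `L(½, ·)`, the anticyclotomic twists), the sealed seesaw datum of the face, the four characters and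
the admissibility of a choice of translates, the torus period `∫_{[T×T′]} χ(t) E^{(2,2)}(ι(t), Φ_{1/2}) dt`, and the
`U(W)`-side: the representations `τ ⊂ L²([U(W)])`, the lift `Θ(β)` of a `U(1)`-character, the toric periods and the
non-vanishing of the lift to `V`.  Each field is the parameter night-2's docstrings describe (PeriodCloserC7.lean);
`S4face` / `WeilPeriodWitness` are the face-side propositions of the chain. -/
structure EndoscopicSide (L : Type) [Field L] [NumberField L] [IsCMField L]
    {Form : Type} [AddCommGroup Form] [Module ℂ Form] {A : FormAlgebra Form} (W : Witness A)
    (Θ : ThetaLifts W) where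
  /-- the Hecke-character interface of `L` -/
  hecke : HeckeInterface L
  /-- the seesaw datum of the face (sealed vocabulary) -/
  seesaw : MuTable.SeesawDatum L
  /-- S4 for the face -/
  S4face : Prop
  /-- the Weil-period witness proposition -/
  WeilPeriodWitness : Prop
  /-- the admissible choices of translates -/
  Admissible : W.Translates → Prop
  /-- the four conjugate-symplectic characters `χ′_j` of a choice -/
  chars : W.Translates → Fin 4 → hecke.HeckeChar
  /-- the torus period of the Siegel–Eisenstein series for a choice -/
  torusPeriod : W.Translates → ℂ
  /-- the automorphic representations `τ ⊂ L²([U(W)])` -/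
  Tau : Type
  /-- the theta lift `Θ(β)` of a `U(1)`-character to `U(W)` -/
  thetaLiftTau : Θ.U1Char → Tau
  /-- the `U(1)`-character `β` of a choice (determined through (E1)) -/
  betaOf : W.Translates → Θ.U1Char
  /-- (P′)(i)/(ii): the toric period of `τ` over the torus `i` against the characters of a choice is non-zero -/
  toricPeriodNonzero : Fin 2 → W.Translates → Tau → Prop
  /-- (P′)(iii): the lift of `τ` to `V` is non-zero with non-zero `(2,0)`-component -/
  liftNonzero : Tau → Prop
  /-- (E1) for the torus `i` -/
  Compat : Fin 2 → W.Translates → Prop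
  /-- (E2) for the torus `i` at the place `v` -/
  LocalRootCond : Fin 2 → hecke.Place → W.Translates → Prop

namespace EndoscopicSide

variable {L : Type} [Field L] [NumberField L] [IsCMField L]
  {Form : Type} [AddCommGroup Form] [Module ℂ Form] {A : FormAlgebra Form} {W : Witness A}
  {Θ : ThetaLifts W} (E : EndoscopicSide L W Θ)

/-- **The face interface of the Tier-4 datum**: night-2's `C7Face L` with `Datum := W.Translates` («a choice of the
Hecke translates») and `hodgePairing := W.hodgePairing` (`⟨f^*Ω_s, f^*Ω_{s̄}⟩_{L²(X)}`). -/
def toC7Face : C7Face L where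
  toHeckeInterface := E.hecke
  seesaw := E.seesaw
  S4face := E.S4face
  WeilPeriodWitness := E.WeilPeriodWitness
  Datum := W.Translates
  Admissible := E.Admissible
  chars := E.chars
  hodgePairing := W.hodgePairing
  torusPeriod := E.torusPeriod
  Tau := E.Tau
  U1Char := Θ.U1Char
  thetaLift := E.thetaLiftTau
  betaOf := E.betaOf
  toricPeriodNonzero := E.toricPeriodNonzero
  liftNonzero := E.liftNonzero
  Compat := E.Compat
  LocalRootCond := E.LocalRootCond

/-- The datum of the face interface is a choice of translates. -/
theorem toC7Face_Datum : E.toC7Face.Datum = W.Translates := rfl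

/-- The Hodge pairing of the face interface is the sentence's pairing. -/
theorem toC7Face_hodgePairing (γ : W.Translates) : E.toC7Face.hodgePairing γ = W.hodgePairing γ := rfl

/-- **(P) of the face interface IS `Witness.P`**: the landed chain speaks about the Tier-4 sentence by name. -/
theorem toC7Face_P : E.toC7Face.P ↔ W.P := Iff.rfl

/-- (R2) of the face interface for a choice: the four central values `L(½, χ′_j)` are non-zero. -/
theorem toC7Face_R2 (γ : W.Translates) :
    E.toC7Face.R2 γ ↔ ∀ j : Fin 4, E.hecke.centralValue (E.chars γ j) ≠ 0 := Iff.rfl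

/-- (R1) of the face interface for a choice: the four root numbers are `+1`. -/
theorem toC7Face_R1 (γ : W.Translates) :
    E.toC7Face.R1 γ ↔ ∀ j : Fin 4, E.hecke.rootNumber (E.chars γ j) = 1 := Iff.rfl

end EndoscopicSide

/-! ## The torus side and the bridge to the landed `DoublingInterface` -/

/-- **The torus side of the doubling form**: the points of `[T × T′] = [U(W_0) × U(W_1) × U(W_2) × U(W_3)]`, the
period functional `F ↦ ∫_{[T×T′]} (χ_0 ⊗ χ_1 ⊗ χ̄_2 ⊗ χ̄_3)(t) F(t) dt` of a choice, the theta integral of the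
doubled space and the Siegel–Eisenstein series at `s = 1/2` restricted to `[T × T′]` (night-2's
`DoublingInterface` fields that are not forms). -/
structure TorusSide {Form : Type} [AddCommGroup Form] [Module ℂ Form] {A : FormAlgebra Form} (W : Witness A) where
  /-- the points of `[T × T′]` -/
  TorusPt : Type
  /-- the period functional of a choice -/
  period : W.Translates → (TorusPt → ℂ) → ℂ
  /-- the theta integral of the doubled space, restricted to `[T × T′]` -/
  thetaIntegral : W.Translates → TorusPt → ℂ
  /-- the Siegel–Eisenstein series at `s = 1/2`, restricted to `[T × T′]` -/
  eisenstein : W.Translates → TorusPt → ℂ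

namespace EndoscopicSide

variable {L : Type} [Field L] [NumberField L] [IsCMField L]
  {Form : Type} [AddCommGroup Form] [Module ℂ Form] {A : FormAlgebra Form} {W : Witness A}
  {Θ : ThetaLifts W} (E : EndoscopicSide L W Θ) (S : TorusSide W)

/-- **The doubling interface of the Tier-4 datum** on the seam: forms, wedge and pairing from `FormAlgebra`, the
corner forms `f^*ω_j`, the line lifts `T_{γ_j}^* θ(μ_j)`, the plane lifts = the wedges of the two line lifts of
each torus, and the torus side `S`. -/
def toDoubling : DoublingInterface E.toC7Face where
  Form := Form
  hodge := fun α β => A.hodge α β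
  wedge := fun α β => A.wedge α β
  cornerForm := fun γ j => W.pullOmega γ j
  lineLift := fun γ j => Θ.translatedLift γ j
  planeLift := fun γ i => A.wedge (Θ.translatedLift γ (line i 0)) (Θ.translatedLift γ (line i 1))
  TorusPt := S.TorusPt
  period := S.period
  thetaIntegral := S.thetaIntegral
  eisenstein := S.eisenstein

/-- **(D0) holds**: the corner forms are the line lifts (`omega_eq_theta`). -/
theorem cornerLifts_toDoubling : CornerLifts E.toC7Face (E.toDoubling S) := fun γ j =>
  Θ.pullOmega_eq γ j

/-- **(D1) holds**: the Hodge pairing is the pairing of the two wedges of corner forms. -/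
theorem witnessForms_toDoubling : WitnessForms E.toC7Face (E.toDoubling S) := by
  intro γ
  obtain ⟨h00, h01, h10, h11⟩ := line_vals
  show W.hodgePairing γ = A.hodge (A.wedge (W.pullOmega γ (line 0 0)) (W.pullOmega γ (line 0 1)))
    (A.wedge (W.pullOmega γ (line 1 0)) (W.pullOmega γ (line 1 1)))
  rw [h00, h01, h10, h11]
  rfl

/-- **(D2) holds**: the plane lifts are the wedges of the line lifts. -/
theorem cupProduct_toDoubling : CupProduct E.toC7Face (E.toDoubling S) := fun _ _ => rfl

/-- **The doubling components from the analytic three**: with (D3) the doubling identity, (D4) Siegel–Weil and the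
definitional match of the torus period, `DoublingComponents` holds — (D0)–(D2) being definitional here. -/
theorem doublingComponents_of (h3 : DoublingIdentity E.toC7Face (E.toDoubling S))
    (h4 : SiegelWeil E.toC7Face (E.toDoubling S)) (hT : TorusPeriodDef E.toC7Face (E.toDoubling S)) :
    DoublingComponents E.toC7Face (E.toDoubling S) where
  corner := E.cornerLifts_toDoubling S
  forms := E.witnessForms_toDoubling S
  cup := E.cupProduct_toDoubling S
  doubling := h3
  siegelWeil := h4
  torusDef := hT

/-- **(P) ⟺ the torus period is non-zero for some choice**, from the analytic three (night-2's
`P_iff_torusPeriod_of_components` on the Tier-4 datum). -/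
theorem P_iff_torusPeriod_of (h3 : DoublingIdentity E.toC7Face (E.toDoubling S))
    (h4 : SiegelWeil E.toC7Face (E.toDoubling S)) (hT : TorusPeriodDef E.toC7Face (E.toDoubling S)) :
    W.P ↔ ∃ γ : W.Translates, E.torusPeriod γ ≠ 0 :=
  P_iff_torusPeriod_of_components E.toC7Face (E.toDoubling S) (E.doublingComponents_of S h3 h4 hT)

end EndoscopicSide

end Summit.Ventures.HodgeRepro.Tier4.Common

end
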